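import Literature.AlgebraicGeometry.Frobenioids.ArchimedeanPullbacks
import HarnessLib

/-!
# Frobenioids II, Example 3.3 (ii): [FrdI] Def. 1.3 (i)(b), (iii)(b), (iii)(c) for `C₀`

Mochizuki, *The geometry of Frobenioids II: poly-Frobenioids*, Kyushu J. Math. **62** (2008)
401–460, §3, Example 3.3 (ii), author's text p. 28 [cite: MochizukiFrdII2008, Ex 3.3 (ii) p.28];
clauses of [FrdI] Def. 1.3 (found's `Frobenioid.lean`) for abc-iut-L1-t6's `C₀ → F_{Φ₀}`.
PROOF-ONLY file (no definition).  Contents (all PROVED): (i)(b) every base isomorphism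
`A_D ≅ B_D` is `Base(ψ) ∘ Base(φ)⁻¹` for pre-steps out of a common object — a small angular sector
fitting into both regions (`i_b`); (iii)(b) if some `A' → A` is a co-angular pre-step then every
`A' → A` is co-angular — "angular regions never shrink" (Lemma 3.2 (iv)) in the form of the rigidity
of connected open subsets of `S¹` under rotations, plus the reflection trick (`iii_b`); (iii)(c) a
co-angular pre-step `φ = (f, 1, c) : A → B` transports `O^▷(A)` onto `O^▷(B)` by `a ↦ f(a)`, with
`φ ∘ α = β ∘ φ`, depending only on `Base(φ) = f` (`iii_c`, `iii_c_base`).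
-/

namespace Literature.AlgebraicGeometry.Frobenioids

open CategoryTheory Set Function Topology
open scoped Pointwise

noncomputable section

namespace ArchFrd

namespace C0

variable {X Y Z : C0}

/-! ### Def. 1.3 (i)(b): base isomorphisms come from pairs of pre-steps -/

/-- **Def. 1.3 (i)(b) for `C₀`**: for every isomorphism `α : A_D ⥲ B_D` of `D₀` there are pre-steps
`φ : X → A`, `ψ : X → B` with `α ∘ Base(φ) = Base(ψ)`; `X` is a small sector of `A` rotated into
`B|_α` (complex case) or `A` itself (real case). [cite: MochizukiFrdII2008, Ex 3.3 (ii) p.28] -/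
theorem i_b (A B : C0) (α : A.base ≅ B.base) :
    ∃ (X : C0) (φ : X ⟶ A) (ψ : X ⟶ B), PreFrobenioid.IsPreStep toElem φ ∧
      PreFrobenioid.IsPreStep toElem ψ ∧ Base φ ≫ α.hom = Base ψ := by
  obtain ⟨A', hA'c, hA't, hA'd, hA'i⟩ := exists_pulledRegion B α.hom
  -- a point `p` of `A.dir`, a point `q` of the twisted `B.dir`
  obtain ⟨p, hp⟩ := A.region.dir_nonempty
  obtain ⟨q, hq⟩ := A'.dir_nonempty
  -- the rotation `w = q p⁻¹` (as a scalar of `A.base`) and a small sector around `p`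
  rcases D0.isReal_or_isComplex A.base with hA | hA
  · -- real case: `X := A`, `φ := 𝟙`, `ψ := (α, 1, λ_B/λ_A)`
    have hB : A'.IsIsotropic :=
      hA'i (isNaivelyIsotropic_of_isRealObj (D0.eq_real_of_hom_real (by rw [← hA]; exact α.hom)))
    obtain ⟨ψ, hψb, hψd, -⟩ := exists_hom A B α.hom 1
      (c := ofPosReal ℂ (B.region.tip * A.region.tip⁻¹)) (ofPosReal_mem_scalars _ _) hA'c
      (by rw [show A'.dir = univ from hB]; exact Set.subset_univ _)
      (by
        rw [coe_ofPosReal, RCLike.norm_ofReal, Positive.val_mul, Positive.coe_inv, PNat.one_coe, pow_one,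
          hA't, tip_eq, abs_of_pos (mul_pos B.region.tip.2 (inv_pos.2 A.region.tip.2)),
          inv_mul_cancel_right₀ A.region.tip.2.ne'])
    have hψp : PreFrobenioid.IsPreStep toElem ψ := by
      refine ⟨hψd, ?_⟩
      rw [isBaseIso_iff, hψb]
      infer_instance
    refine ⟨A, 𝟙 A, ψ, PreFrobenioid.isPreStep_of_isIso toElem _, hψp, ?_⟩
    rw [hψb]
    exact Category.id_comp _
  · -- complex case
    let w : normOneSubgroup ℂ := q * p⁻¹
    have hU : IsOpen (A.region.dir ∩ w⁻¹ • A'.dir) :=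
      A.region.isOpen_dir.inter (isOpen_smul _ A'.isOpen_dir)
    have hpU : p ∈ A.region.dir ∩ w⁻¹ • A'.dir :=
      ⟨hp, ⟨q, hq, by show (q * p⁻¹)⁻¹ • q = p; rw [smul_eq_mul, mul_inv_rev, inv_inv,
        inv_mul_cancel_right]⟩⟩
    obtain ⟨V, hVo, hVc, hpV, hVU⟩ := exists_isConnected_isOpen_subset hU hpU
    obtain ⟨AX, hAXd, hAXt⟩ := exists_angularRegion hVo hVc (min A.region.tip B.region.tip)
    let X : C0 := ⟨A.base, AX, isIsotropic_of_isReal_absurd hA AX⟩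
    obtain ⟨A'', hA''c, hA''t, hA''d, -⟩ := exists_pulledRegion A (𝟙 A.base)
    rw [twist_id_image] at hA''d
    obtain ⟨φ, hφb, hφd, -⟩ := exists_hom X A (𝟙 A.base) 1 (one_mem _) hA''c
      (by
        rw [hA''d, unitPart_one, one_smul, PNat.one_coe, pow_one]
        change AX.dir ⊆ A.region.dir
        rw [hAXd]; exact hVU.trans Set.inter_subset_left)
      (by
        rw [hA''t, Units.val_one, norm_one, one_mul, PNat.one_coe, pow_one, ← tip_eq]
        change ((AX.tip : PosReal) : ℝ) ≤ A.tip
        rw [hAXt, tip_eq]; exact_mod_cast min_le_left _ _)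
    obtain ⟨ψ, hψb, hψd, -⟩ := exists_hom X B α.hom 1 (c := (w : ℂˣ))
      (by rw [show X.base = D0.complex from hA, D0.scalars_complex]; trivial) hA'c
      (by
        rw [unitPart_normOne_coe, PNat.one_coe, pow_one]
        change w • AX.dir ⊆ A'.dir
        rw [hAXd]
        refine (Set.smul_set_mono (hVU.trans Set.inter_subset_right)).trans ?_
        rw [smul_smul, mul_inv_cancel, one_smul])
      (by
        rw [show ‖((w : ℂˣ) : ℂ)‖ = 1 from (mem_normOneSubgroup_iff ℂ _).1 w.2, one_mul,
          PNat.one_coe, pow_one, hA't]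
        change ((AX.tip : PosReal) : ℝ) ≤ _
        rw [hAXt]; exact_mod_cast min_le_right _ _)
    have hφp : PreFrobenioid.IsPreStep toElem φ := by
      refine ⟨hφd, ?_⟩
      rw [isBaseIso_iff, hφb]
      infer_instance
    have hψp : PreFrobenioid.IsPreStep toElem ψ := by
      refine ⟨hψd, ?_⟩
      rw [isBaseIso_iff, hψb]
      infer_instance
    refine ⟨X, φ, ψ, hφp, hψp, ?_⟩
    rw [hφb, hψb]
    exact Category.id_comp _

/-! ### Def. 1.3 (iii)(b): co-angularity into a fixed object propagates -/

/-- The twist of a twisted set. [cite: MochizukiFrdII2008, Def 3.1 (iv) p.24] -/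
theorem twist_image_twist_image {L K : D0} (f : L ⟶ K) (B : Set (normOneSubgroup ℂ)) :
    (fun z : normOneSubgroup ℂ => unitPart ℂ (f.act (z : ℂˣ))) ''
      ((fun z : normOneSubgroup ℂ => unitPart ℂ (f.act (z : ℂˣ))) '' B) = B := by
  rw [Set.image_image]
  conv_rhs => rw [← Set.image_id B]
  exact Set.image_congr fun z _ => twist_twist f z

/-- The twist along `f` is the identity or inversion on `O_ℂ^×`, according to the Galois twist of
`f`. [cite: MochizukiFrdII2008, Def 3.1 (iv) p.24] -/
theorem twist_image_eq {L K : D0} (f : L ⟶ K) (B : Set (normOneSubgroup ℂ)) :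
    (fun z : normOneSubgroup ℂ => unitPart ℂ (f.act (z : ℂˣ))) '' B =
      bif D0.Hom.twists f then B⁻¹ else B := by
  unfold D0.Hom.act
  cases D0.Hom.twists f
  · change (fun z : normOneSubgroup ℂ => unitPart ℂ (D0.galAct false (z : ℂˣ))) '' B = B
    conv_rhs => rw [← Set.image_id B]
    exact Set.image_congr fun z _ => by rw [unitPart_galAct_coe]; rfl
  · change (fun z : normOneSubgroup ℂ => unitPart ℂ (D0.galAct true (z : ℂˣ))) '' B = B⁻¹
    rw [← Set.image_inv_eq_inv]
    exact Set.image_congr fun z _ => by rw [unitPart_galAct_coe]; rfl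

/-- `b^n · B ⊆ B^{n+1}` for `b ∈ B`. [cite: MochizukiFrdII2008, Def 3.1 (iii) p.24] -/
theorem smul_subset_pow {G : Type*} [CommGroup G] {B : Set G} {b : G} (hb : b ∈ B) :
    ∀ n : ℕ, b ^ n • B ⊆ B ^ (n + 1)
  | 0 => by rw [pow_zero, one_smul, zero_add, pow_one]
  | n + 1 => by
    rw [pow_succ, mul_comm, mul_smul, pow_succ _ (n + 1)]
    rintro _ ⟨_, ⟨x, hx, rfl⟩, rfl⟩
    refine ⟨b ^ n • x, smul_subset_pow hb n (Set.smul_mem_smul_set hx), b, hb, ?_⟩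
    show b ^ n * x * b = b * (b ^ n * x)
    rw [mul_comm]

/-- A rotation carrying a connected open `T ⊆ O_ℂ^×` into `T`, or into `T⁻¹`, is onto it (rigidity
under rotations, resp. the reflection trick `T ⊆ ρ(T) ⇒ ρ(T) ⊆ ρρ(T) = T`).
[cite: MochizukiFrdII2008, Lem 3.2 (iv) p.25] -/
theorem smul_eq_of_subset_twist {T : Set (normOneSubgroup ℂ)} (hT : IsConnected T) (hTo : IsOpen T)
    (w : normOneSubgroup ℂ) (σ : Bool) (h : w • T ⊆ bif σ then T⁻¹ else T) :
    w • T = bif σ then T⁻¹ else T := by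
  cases σ
  · exact smul_set_eq_self_of_subset hT hTo h
  · change w • T ⊆ T⁻¹ at h
    change w • T = T⁻¹
    refine le_antisymm h fun z hz => ?_
    have h1 : w • z⁻¹ ∈ T⁻¹ := h (Set.smul_mem_smul_set (Set.mem_inv.mp hz))
    rw [Set.mem_inv, smul_eq_mul, mul_inv_rev, inv_inv] at h1
    exact ⟨z * w⁻¹, h1, by show w * (z * w⁻¹) = z; rw [mul_comm z, mul_inv_cancel_left]⟩

/-- **Def. 1.3 (iii)(b) for `C₀`**: if `φ : A' → A` is a co-angular pre-step, then every `ψ : A' → A` is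
co-angular.  With `B' = u₀⁻¹ · τ_φ(B)` (co-angularity of `φ`) and `u' · B'^d ⊆ τ_ψ(B)`, the rotation
`v = u' b^{d-1} u₀⁻¹` (`b ∈ B'`) carries `τ_φ(B)` into `τ_ψ(B) ∈ {τ_φ(B), τ_φ(B)⁻¹}`, hence onto it
("angular regions never shrink"), and then `u' · B'^d ⊇ v · τ_φ(B) = τ_ψ(B)`.
[cite: MochizukiFrdII2008, Ex 3.3 (ii) p.28] -/
theorem iii_b (φ : X ⟶ Y) (hφ : PreFrobenioid.IsCoAngularPreStep toElem φ) (ψ : X ⟶ Y) :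
    PreFrobenioid.IsCoAngular toElem ψ := by
  apply isCoAngular_of_isNaivelyCoAngular
  intro hX
  rw [image_unitPart_homImage, image_unitPart_pullRegion]
  have hφn := isNaivelyCoAngular_of_isCoAngular φ hφ.1 hX
  rw [image_unitPart_homImage, image_unitPart_pullRegion, show degFr φ = 1 from hφ.2.1,
    PNat.one_coe, pow_one] at hφn
  -- `B' = u₀⁻¹ · τ_φ(B)`
  have hXd : X.region.dir = (unitPart ℂ (scalar φ))⁻¹ •
      (fun z : normOneSubgroup ℂ => unitPart ℂ ((Base φ).act (z : ℂˣ))) '' Y.region.dir := by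
    rw [← hφn, inv_smul_smul]
  -- `u' · B'^d ⊆ τ_ψ(B)`
  obtain ⟨A', hA'c, -, hA'd, -⟩ := exists_pulledRegion Y (Base ψ)
  have hψ := (hom_conditions ψ hA'c).1
  rw [hA'd] at hψ
  obtain ⟨b, hb⟩ := X.region.dir_nonempty
  have hd : (degFr ψ : ℕ) = (degFr ψ).natPred + 1 := (PNat.natPred_add_one _).symm
  have h1 : b ^ (degFr ψ).natPred • X.region.dir ⊆ X.region.dir ^ (degFr ψ : ℕ) := by
    rw [hd]; exact smul_subset_pow hb _
  -- the twisted copies of `B`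
  obtain ⟨σ, hσ⟩ : ∃ σ, D0.Hom.twists (Base φ) = σ := ⟨_, rfl⟩
  obtain ⟨σ', hσ'⟩ : ∃ σ', D0.Hom.twists (Base ψ) = σ' := ⟨_, rfl⟩
  have hTφ : (fun z : normOneSubgroup ℂ => unitPart ℂ ((Base φ).act (z : ℂˣ))) '' Y.region.dir =
      bif σ then Y.region.dir⁻¹ else Y.region.dir := by rw [twist_image_eq, hσ]
  have hTψ : (fun z : normOneSubgroup ℂ => unitPart ℂ ((Base ψ).act (z : ℂˣ))) '' Y.region.dir =
      bif xor σ σ' then (bif σ then Y.region.dir⁻¹ else Y.region.dir)⁻¹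
        else (bif σ then Y.region.dir⁻¹ else Y.region.dir) := by
    rw [twist_image_eq, hσ']
    cases σ <;> cases σ' <;> simp [inv_inv]
  have hTc : IsConnected (bif σ then Y.region.dir⁻¹ else Y.region.dir) := by
    cases σ
    · exact Y.region.isConnected_dir
    · exact isConnected_inv Y.region.isConnected_dir
  have hTo : IsOpen (bif σ then Y.region.dir⁻¹ else Y.region.dir) := by
    cases σ
    · exact Y.region.isOpen_dir
    · exact isOpen_inv' Y.region.isOpen_dir
  -- the rotation `v`
  have hv : (unitPart ℂ (scalar ψ) * b ^ (degFr ψ).natPred * (unitPart ℂ (scalar φ))⁻¹) •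
      (bif σ then Y.region.dir⁻¹ else Y.region.dir) ⊆
        bif xor σ σ' then (bif σ then Y.region.dir⁻¹ else Y.region.dir)⁻¹
          else (bif σ then Y.region.dir⁻¹ else Y.region.dir) := by
    rw [← hTψ, ← hTφ, mul_smul, mul_smul, ← hXd]
    exact (Set.smul_set_mono h1).trans hψ
  have heq := smul_eq_of_subset_twist hTc hTo _ _ hv
  -- conclude
  refine le_antisymm hψ ?_
  rw [hTψ, ← heq, mul_smul, mul_smul, ← hTφ, ← hXd]
  exact Set.smul_set_mono h1

end C0

end ArchFrd

end

end Literature.AlgebraicGeometry.Frobenioids
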